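import Literature.NumberTheory.EllipticCurves.QuadraticOrderEisensteinNumbers
import Literature.NumberTheory.EllipticCurves.EisensteinValuesAtRhoSix
import Literature.NumberTheory.EllipticCurves.RealLatticePeriod
import HarnessLib

/-!
# The order `𝒪₃ = ℤω₃ + ℤ` of `QuadraticOrderEisensteinNumbers` IS the hexagonal lattice `ℤρ + ℤ` (`ω₃ = ρ + 1`)

Topic `Literature/NumberTheory/EllipticCurves` (complex-lattice cluster; namespace `Literature.NumberTheory.EllipticCurves.QuadOrder`,
continuing `QuadraticOrderEisensteinNumbers.lean`). Theorems only. The tree carries the CM lattice of `y² = x³ + k` in two guises: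
`QuadOrder.periodPair 3 = (ω₃, 1)`, `ω₃ = (1 + √−3)/2`, on which the weight-one theta machinery delivers Eisenstein numbers at division
points (`QuadOrder.thetaLFunction_parityLift_one`, `QuadOrder.eisensteinE₁_divPoint`), and `PeriodPair.ofUpperHalfPlane UpperHalfPlane.ρ
= (ρ, 1)`, `ρ = e^{2πi/3} = ω₃ − 1`, on which the CM values live (`EisensteinValuesAtRho(Six)`, `EisensteinLatticeCMThree`, the `j = 0`
torsion cores). This file identifies them:

* `omega_three` (`ω₃ = ρ + 1`), `periodPair_three_lattice_eq` (the lattices coincide), `eisensteinE₁_periodPair_three`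
  (`E₁(·; 𝒪₃) = E₁(·; ℤρ + ℤ)`), `weierstrassP_periodPair_three` (`℘_{𝒪₃} = ℘_{ℤρ+ℤ}`);
* `divPoint_three` (`(d₁ + d₂ω₃)/M = (d₂ρ + (d₁ + d₂))/M`) and ★ `eisensteinE₁_add_divPoint_three` — for every `w`,
  `E₁(w + (d₁ + d₂ω₃)/M; 𝒪₃) = E₁(w + (d₂ρ + (d₁ + d₂ mod M))/M; ℤρ + ℤ)`, the reindexing `(d₁, d₂) ↦ (d₂, d₁ + d₂)` of `(ℤ/M)²`
  between the theta side's division points and the `ρ`-coordinates `(e₁ρ + e₂)/M` (an integer shift is absorbed by periodicity).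
[cite: Rubin1999, §7.4 Prop. 7.15 (LNM 1716 p. 245)] [cite: Cox2013, §10.C]
-/

noncomputable section

open Complex PeriodPair

namespace Literature.NumberTheory.EllipticCurves

namespace QuadOrder

/-- `ω₃ = (1 + √−3)/2 = ρ + 1` (the maximal order of `ℚ(√−3)` is `ℤ[ω₃] = ℤ[ρ]`). [cite: Cox2013, §7.A] -/
theorem omega_three : omega 3 = (UpperHalfPlane.ρ : ℂ) + 1 := by
  have hρ : ((UpperHalfPlane.ρ : UpperHalfPlane) : ℂ) = ⟨-1 / 2, Real.sqrt 3 / 2⟩ := rfl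
  rw [hρ, omega]
  apply Complex.ext
  · simp; norm_num
  · simp

/-- **`𝒪₃ = ℤω₃ + ℤ = ℤρ + ℤ`** as lattices. [cite: Cox2013, §7.A] -/
theorem periodPair_three_lattice_eq : (periodPair 3).lattice = (ofUpperHalfPlane UpperHalfPlane.ρ).lattice := by
  ext x
  rw [mem_lattice_iff, EisensteinLattice.mem_lattice_iff, omega_three]
  constructor
  · rintro ⟨m, n, rfl⟩
    exact ⟨m, m + n, by push_cast; ring⟩
  · rintro ⟨m, n, rfl⟩
    exact ⟨m, n - m, by push_cast; ring⟩

/-- `E₁(·; 𝒪₃) = E₁(·; ℤρ + ℤ)` (the Eisenstein number depends only on the lattice). [cite: Rubin1999, §7.4 Def. 7.11] -/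
theorem eisensteinE₁_periodPair_three (z : ℂ) :
    (periodPair 3).eisensteinE₁ z = (ofUpperHalfPlane UpperHalfPlane.ρ).eisensteinE₁ z := by
  rw [eisensteinE₁_eq_of_lattice_eq periodPair_three_lattice_eq]

/-- `℘_{𝒪₃} = ℘_{ℤρ+ℤ}` (`℘` depends only on the lattice). [cite: Cox2013, §10.C] -/
theorem weierstrassP_periodPair_three : ℘[periodPair 3] = ℘[ofUpperHalfPlane UpperHalfPlane.ρ] :=
  weierstrassP_eq_of_lattice_eq periodPair_three_lattice_eq

variable (M : ℕ) [NeZero M]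

omit [NeZero M] in
/-- The division point `(d₁ + d₂ω₃)/M` in `ρ`-coordinates: `= (d₂ρ + (d₁ + d₂))/M`. [cite: Rubin1999, §7.4 Prop. 7.15 (LNM 1716 p. 245)] -/
theorem divPoint_three (d : ZMod M × ZMod M) :
    divPoint 3 M d = ((d.2.val : ℂ) * UpperHalfPlane.ρ + ((d.1.val : ℂ) + d.2.val)) / M := by
  rw [divPoint, omega_three]; ring

/-- ★ **Reindexing the division points**: for every `w ∈ ℂ` and `d = (d₁, d₂) mod M`,
`E₁(w + (d₁ + d₂ω₃)/M; 𝒪₃) = E₁(w + ((d₂ mod M)·ρ + ((d₁ + d₂) mod M))/M; ℤρ + ℤ)` — the theta side's division points of `𝒪₃`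
are the points `(e₁ρ + e₂)/M`, `e = (d₂, d₁ + d₂)`, of the `ρ`-coordinates, up to an integer (absorbed by periodicity).
[cite: Rubin1999, §7.4 Prop. 7.15 (LNM 1716 p. 245)] -/
theorem eisensteinE₁_add_divPoint_three (w : ℂ) (d : ZMod M × ZMod M) :
    (periodPair 3).eisensteinE₁ (w + divPoint 3 M d) =
      (ofUpperHalfPlane UpperHalfPlane.ρ).eisensteinE₁
        (w + (((d.2.val : ℂ)) * UpperHalfPlane.ρ + (((d.1 + d.2).val : ℕ) : ℂ)) / M) := by
  rw [eisensteinE₁_periodPair_three, divPoint_three]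
  -- the two arguments differ by the integer `(d₁.val + d₂.val − (d₁ + d₂).val)/M`
  have hM : (M : ℂ) ≠ 0 := Nat.cast_ne_zero.mpr (NeZero.ne M)
  obtain ⟨j, hj⟩ : ∃ j : ℕ, d.1.val + d.2.val = (d.1 + d.2).val + M * j :=
    ⟨(d.1.val + d.2.val) / M, by rw [ZMod.val_add]; exact (Nat.mod_add_div _ _).symm⟩
  have hshift : w + ((d.2.val : ℂ) * UpperHalfPlane.ρ + ((d.1.val : ℂ) + d.2.val)) / M =
      (w + (((d.2.val : ℂ)) * UpperHalfPlane.ρ + (((d.1 + d.2).val : ℕ) : ℂ)) / M) + (j : ℂ) := by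
    have h := congrArg (fun n : ℕ ↦ (n : ℂ)) hj
    push_cast at h
    field_simp
    linear_combination h
  rw [hshift]
  exact eisensteinE₁_add_of_mem_lattice _ (EisensteinLattice.mem_lattice_iff.mpr ⟨0, j, by simp⟩) _

end QuadOrder

end Literature.NumberTheory.EllipticCurves

end
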